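import Summits.RiemannHypothesis.RiemannHypothesis.Theorems.HandoffRankOnePencil
import HarnessLib

/-!
# HANDOFF — the rank-one capacity as a SPECTRAL SUM, and the one-mode / all-mode sandwich of the crossing (cell rh-explicit, TRACK «HANDOFF», seat theory-2 gen7, file XII-o; a PROVABLE-NOW T1 shard, sequel of XII-l `HandoffRankOnePencil`)

HONEST FRAMING. Nothing here bears on the truth of RH; this is finite-dimensional real linear algebra. RH-PROMISE § 0′ T1.4 (L1)
displays the capacity of the wall-offset law as «`Cap(q) := ⟨b_q, A_q⁻¹ b_q⟩ = Σ_k e_k²/ε_k`» (`A_q` the Gram matrix of Weil's form on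
a section at the entrance bandwidth, `ε_k` its levels, `e_k` the entrance/edge amplitudes of the eigenvectors, `b_q` the entrance profile)
and (L2d) «EQUIPARTITION: `e_k²/ε_k ≈ const·q` over `K_q` near-null modes»; MARGIN-LAW §1.2 / T17 §21 use the same bookkeeping. After XII-l
(the crossing `t* = 1/⟨v, A⁻¹v⟩` of the pencil `A − t·v vᵀ`, kernel) this file kernel-checks the remaining ALGEBRA of that display:
* §1 `eigenvalue_pos`, **`sq_dotProduct_div_le_resolvent`** — ONE MODE FROM BELOW: for an eigenpair `A u = λ u`, `u ≠ 0`, of `A ≻ 0`: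
  `(u·v)²/(λ·(u·u)) ≤ ⟨v, A⁻¹v⟩` (Cauchy–Schwarz of XII-l tested on `u`); more generally every PARTIAL spectral sum is a lower bound (§3).
* §2 **`resolvent_le_dotProduct_self_div`** — ALL MODES FROM ABOVE: if `A ⪰ m·1` with `m > 0` (i.e. `m·(x·x) ≤ x·Ax` for all `x`) then
  `⟨v, A⁻¹v⟩ ≤ (v·v)/m`.
  Hence the CROSSING SANDWICH for the pencil (`t ≥ 0`): `t·(v·v) ≤ m ⟹ A − t·v vᵀ ⪰ 0` (`posSemidef_sub_rankOne_of_mul_dotProduct_self_le`) and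
  `A − t·v vᵀ ⪰ 0 ⟹ t·(u·v)² ≤ λ·(u·u)` for every eigenpair (`mul_sq_dotProduct_le_of_posSemidef_sub_rankOne`): **`m/(v·v) ≤ t* ≤ λ₁·(u₁·u₁)/(u₁·v)²`**
  — the «bottom-mode-only» estimate of the crossing is an UPPER bound, the «all modes at the bottom level» estimate a LOWER bound; the true
  `t*` sits between them by exactly the factor that (L2c)/(L2d) call the mode count / equipartition.
* §3 **`resolvent_eq_sum_sq_dotProduct_div`** — THE SPECTRAL SUM: for an orthonormal eigenbasis `(u_i, λ_i)` of `A ≻ 0` (hypotheses stated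
  as plain `dotProduct` facts: orthonormality, completeness `Σ_i (u_i·x) u_i = x`, `A u_i = λ_i u_i`), **`⟨v, A⁻¹v⟩ = Σ_i (u_i·v)²/λ_i`**, and
  `sum_sq_dotProduct_div_le_resolvent`: every sub-family of modes under-estimates it (works for any certified eigen-decomposition
  of a section, stated by `dotProduct` facts only).
* §4 INSTANTIATION with Mathlib's `Matrix.IsHermitian.eigenvectorBasis` / `eigenvalues` (orthonormality and completeness moved from
  `EuclideanSpace ℝ n` to `dotProduct` form): **`resolvent_eq_sum_eigenvectorBasis : ⟨v, A⁻¹v⟩ = Σ_i (u_i·v)²/λ_i`** and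
  `posSemidef_sub_rankOne_iff_sum_eigenvectorBasis : A − t·v vᵀ ⪰ 0 ↔ t·Σ_i (u_i·v)²/λ_i ≤ 1` (`t ≥ 0`) — hypothesis-free forms.
What is NOT here (MODEL/DERIVED in T1, unchanged): which matrix `A` and profile `v` model the prime's entrance, the linearisation in the
overshoot `δ` and its error term (L1), the level law (L2a), the mode count (L2c), any `N → ∞` (XII-h/XII-k: at `N = ∞` the capacity has a
logarithmic foot and no linear law survives there). References: R. Frank, A. Laptev, T. Weidl, *Schrödinger Operators: Eigenvalues and
Lieb–Thirring Inequalities* (CUP 2023) §1.2.8 (Birman–Schwinger for finite rank); J. Sherman, W. Morrison, Ann. Math. Stat. 21 (1950).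
All statements are folklore linear algebra.
-/

set_option linter.dupNamespace false  -- the mandated namespace repeats `RiemannHypothesis`

open Matrix Finset
open scoped InnerProductSpace
open Summit.RiemannHypothesis.RiemannHypothesis.Theorems.HandoffRankOnePencil

namespace Summit.RiemannHypothesis.RiemannHypothesis.Theorems.HandoffCapacitySpectral

variable {n : Type*} [Fintype n] [DecidableEq n] {A : Matrix n n ℝ} {u v : n → ℝ} {l m t : ℝ}

/-! ## §1 One mode from below -/

omit [DecidableEq n] in
/-- `u·u > 0` for `u ≠ 0`. [folklore] -/
theorem dotProduct_self_pos (hu : u ≠ 0) : 0 < u ⬝ᵥ u := by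
  refine lt_of_le_of_ne (Finset.sum_nonneg fun i _ ↦ mul_self_nonneg (u i)) (fun h ↦ hu ?_)
  exact dotProduct_self_eq_zero.1 h.symm

omit [DecidableEq n] in
/-- An eigenvalue of a positive definite real matrix is positive: `A u = λ u`, `u ≠ 0` ⟹ `0 < λ`. [folklore] -/
theorem eigenvalue_pos (hA : A.PosDef) (hu : u ≠ 0) (heig : A *ᵥ u = l • u) : 0 < l := by
  have h := hA.dotProduct_mulVec_pos hu
  rw [star_trivial, heig, dotProduct_smul, smul_eq_mul] at h
  exact pos_of_mul_pos_left h (dotProduct_self_pos hu).le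

omit [DecidableEq n] in
/-- The `A`-energy of an eigenvector: `u·(Au) = λ·(u·u)`. [folklore] -/
theorem dotProduct_mulVec_eigen (heig : A *ᵥ u = l • u) : u ⬝ᵥ (A *ᵥ u) = l * (u ⬝ᵥ u) := by
  rw [heig, dotProduct_smul, smul_eq_mul]

/-- **One mode from below**: for an eigenpair `A u = λ u`, `u ≠ 0`, of `A ≻ 0` and every `v`,
`(u·v)² ≤ ⟨v, A⁻¹v⟩ · λ·(u·u)`. [folklore] -/
theorem sq_dotProduct_le_resolvent_mul (hA : A.PosDef) (heig : A *ᵥ u = l • u) (v : n → ℝ) :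
    (u ⬝ᵥ v) ^ 2 ≤ (v ⬝ᵥ (A⁻¹ *ᵥ v)) * (l * (u ⬝ᵥ u)) := by
  rw [dotProduct_comm u v, ← dotProduct_mulVec_eigen heig]
  exact sq_dotProduct_le_resolvent hA v u

/-- … in quotient form: **`(u·v)²/(λ·(u·u)) ≤ ⟨v, A⁻¹v⟩`** — one term of the spectral sum under-estimates the capacity. [folklore] -/
theorem sq_dotProduct_div_le_resolvent (hA : A.PosDef) (hu : u ≠ 0) (heig : A *ᵥ u = l • u) (v : n → ℝ) :
    (u ⬝ᵥ v) ^ 2 / (l * (u ⬝ᵥ u)) ≤ v ⬝ᵥ (A⁻¹ *ᵥ v) :=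
  (div_le_iff₀ (mul_pos (eigenvalue_pos hA hu heig) (dotProduct_self_pos hu))).2 (sq_dotProduct_le_resolvent_mul hA heig v)

/-! ## §2 All modes from above, and the crossing sandwich -/

/-- **All modes from above**: if `m·(x·x) ≤ x·(Ax)` for every `x` (`A ⪰ m·1`) with `0 < m`, then `⟨v, A⁻¹v⟩ ≤ (v·v)/m`. [folklore] -/
theorem resolvent_le_dotProduct_self_div (hA : A.PosDef) (hm0 : 0 < m) (hm : ∀ x : n → ℝ, m * (x ⬝ᵥ x) ≤ x ⬝ᵥ (A *ᵥ x))
    (v : n → ℝ) : v ⬝ᵥ (A⁻¹ *ᵥ v) ≤ (v ⬝ᵥ v) / m := by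
  -- Cauchy–Schwarz for the dot product `(v·w)² ≤ (v·v)(w·w)` (the tree's `…B9Thm311.dot_sq_le` states it in a QFT file — inlined here)
  have h2 : (v ⬝ᵥ (A⁻¹ *ᵥ v)) ^ 2 ≤ (v ⬝ᵥ v) * ((A⁻¹ *ᵥ v) ⬝ᵥ (A⁻¹ *ᵥ v)) := by
    have h := sum_mul_sq_le_sq_mul_sq Finset.univ v (A⁻¹ *ᵥ v)
    simpa only [dotProduct, sq] using h
  set w := A⁻¹ *ᵥ v with hw
  set c := v ⬝ᵥ w with hc
  have hAw : A *ᵥ w = v := mulVec_inv_mulVec hA v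
  have hc0 : 0 ≤ c := resolvent_nonneg hA v
  -- `c = w·(Aw) ≥ m·(w·w)`
  have h1 : m * (w ⬝ᵥ w) ≤ c := by
    have := hm w
    rwa [hAw, dotProduct_comm w v] at this
  rw [le_div_iff₀ hm0]
  have hvv : 0 ≤ v ⬝ᵥ v := Finset.sum_nonneg fun i _ ↦ mul_self_nonneg (v i)
  rcases hc0.lt_or_eq with hcpos | hczero
  · -- `c²·m ≤ (v·v)·(w·w)·m ≤ (v·v)·c`
    nlinarith [mul_le_mul_of_nonneg_left h1 hvv]
  · rw [← hczero, zero_mul]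
    exact hvv

/-- **Crossing, lower side**: `t ≥ 0`, `t·(v·v) ≤ m`, `A ⪰ m·1` (`m > 0`) ⟹ `A − t·v vᵀ ⪰ 0` — the coupling below which positivity is
GUARANTEED by the bottom level alone: `t* ≥ m/(v·v)`. [folklore] -/
theorem posSemidef_sub_rankOne_of_mul_dotProduct_self_le (hA : A.PosDef) (hm0 : 0 < m)
    (hm : ∀ x : n → ℝ, m * (x ⬝ᵥ x) ≤ x ⬝ᵥ (A *ᵥ x)) (ht : 0 ≤ t) (htv : t * (v ⬝ᵥ v) ≤ m) :
    (A - t • vecMulVec v v).PosSemidef := by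
  refine (posSemidef_sub_rankOne_iff hA v ht).2 ?_
  have h := resolvent_le_dotProduct_self_div hA hm0 hm v
  calc t * (v ⬝ᵥ (A⁻¹ *ᵥ v)) ≤ t * ((v ⬝ᵥ v) / m) := mul_le_mul_of_nonneg_left h ht
    _ = t * (v ⬝ᵥ v) / m := by ring
    _ ≤ 1 := (div_le_one hm0).2 htv

omit [DecidableEq n] in
/-- **Crossing, upper side**: if `A − t·v vᵀ ⪰ 0` then `t·(u·v)² ≤ λ·(u·u)` for every eigenpair `A u = λ u` (test the pencil on `u`) —
positivity is LOST no later than `t = λ·(u·u)/(u·v)²` for any single mode with `u·v ≠ 0`: `t* ≤ λ₁(u₁·u₁)/(u₁·v)²`. [folklore] -/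
theorem mul_sq_dotProduct_le_of_posSemidef_sub_rankOne (heig : A *ᵥ u = l • u)
    (h : (A - t • vecMulVec v v).PosSemidef) : t * (u ⬝ᵥ v) ^ 2 ≤ l * (u ⬝ᵥ u) := by
  have hu := (posSemidef_iff_dotProduct_mulVec.mp h).2 u
  rw [star_trivial, dotProduct_pencil_mulVec, dotProduct_mulVec_eigen heig, dotProduct_comm v u] at hu
  linarith

omit [DecidableEq n] in
/-- … contrapositive: `λ·(u·u) < t·(u·v)²` for some eigenpair ⟹ the pencil is NOT positive semidefinite. [folklore] -/
theorem not_posSemidef_sub_rankOne_of_lt (heig : A *ᵥ u = l • u) (hlt : l * (u ⬝ᵥ u) < t * (u ⬝ᵥ v) ^ 2) :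
    ¬ (A - t • vecMulVec v v).PosSemidef := fun h ↦
  (not_lt.2 (mul_sq_dotProduct_le_of_posSemidef_sub_rankOne heig h)) hlt

/-! ## §3 The spectral sum -/

/-- **THE CAPACITY IS THE SPECTRAL SUM.** Let `A ≻ 0` be real and `(u_i)_{i}` an orthonormal eigenbasis, stated as: `u_i·u_j = δ_ij`,
completeness `Σ_i (u_i·x) u_i = x` for all `x`, and `A u_i = λ_i u_i`. Then **`⟨v, A⁻¹v⟩ = Σ_i (u_i·v)²/λ_i`** (T1.4 (L1)'s displayed
«`Cap = Σ_k e_k²/ε_k`», with `e_k = u_k·v`, `ε_k = λ_k`). [folklore] -/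
theorem resolvent_eq_sum_sq_dotProduct_div (hA : A.PosDef) (U : n → n → ℝ) (lam : n → ℝ)
    (horth : ∀ i j, U i ⬝ᵥ U j = if i = j then 1 else 0) (hcomp : ∀ x : n → ℝ, ∑ i, (U i ⬝ᵥ x) • U i = x)
    (heig : ∀ i, A *ᵥ U i = lam i • U i) (v : n → ℝ) :
    v ⬝ᵥ (A⁻¹ *ᵥ v) = ∑ i, (U i ⬝ᵥ v) ^ 2 / lam i := by
  have hU0 : ∀ i, U i ≠ 0 := fun i h0 ↦ by
    have := horth i i
    rw [if_pos rfl, h0, zero_dotProduct] at this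
    exact zero_ne_one this
  have hlam : ∀ i, 0 < lam i := fun i ↦ eigenvalue_pos hA (hU0 i) (heig i)
  -- the candidate resolvent vector
  set w : n → ℝ := ∑ i, ((U i ⬝ᵥ v) / lam i) • U i with hw
  have hAw : A *ᵥ w = v := by
    rw [hw, mulVec_sum]
    conv_rhs => rw [← hcomp v]
    refine Finset.sum_congr rfl fun i _ ↦ ?_
    rw [mulVec_smul, heig i, smul_smul, div_mul_cancel₀ _ (hlam i).ne']
  have hwinv : A⁻¹ *ᵥ v = w := by
    rw [← hAw, mulVec_mulVec, nonsing_inv_mul _ ((isUnit_iff_isUnit_det _).1 hA.isUnit), one_mulVec]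
  rw [hwinv, hw, dotProduct_sum]
  refine Finset.sum_congr rfl fun i _ ↦ ?_
  rw [dotProduct_smul, smul_eq_mul, dotProduct_comm v (U i)]
  field_simp

/-- **Every sub-family of modes under-estimates the capacity**: `Σ_{i ∈ s} (u_i·v)²/λ_i ≤ ⟨v, A⁻¹v⟩` (all terms are `≥ 0`); `s = {k}` is §1,
`s = ` the near-null modes is (L2c)/(L2d)'s bookkeeping. [folklore] -/
theorem sum_sq_dotProduct_div_le_resolvent (hA : A.PosDef) (U : n → n → ℝ) (lam : n → ℝ)
    (horth : ∀ i j, U i ⬝ᵥ U j = if i = j then 1 else 0) (hcomp : ∀ x : n → ℝ, ∑ i, (U i ⬝ᵥ x) • U i = x)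
    (heig : ∀ i, A *ᵥ U i = lam i • U i) (v : n → ℝ) (s : Finset n) :
    ∑ i ∈ s, (U i ⬝ᵥ v) ^ 2 / lam i ≤ v ⬝ᵥ (A⁻¹ *ᵥ v) := by
  have hU0 : ∀ i, U i ≠ 0 := fun i h0 ↦ by
    have := horth i i
    rw [if_pos rfl, h0, zero_dotProduct] at this
    exact zero_ne_one this
  have hlam : ∀ i, 0 < lam i := fun i ↦ eigenvalue_pos hA (hU0 i) (heig i)
  rw [resolvent_eq_sum_sq_dotProduct_div hA U lam horth hcomp heig v]
  exact Finset.sum_le_sum_of_subset_of_nonneg (Finset.subset_univ s) fun i _ _ ↦ div_nonneg (sq_nonneg _) (hlam i).le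

/-- With the spectral sum, XII-l's crossing reads: for `t ≥ 0`, **`A − t·v vᵀ ⪰ 0 ↔ t·Σ_i (u_i·v)²/λ_i ≤ 1`** — the wall-offset law's
«`2w_q·δ*·Σ_k e_k²/ε_k = 1`» at the level of linear algebra. [folklore] -/
theorem posSemidef_sub_rankOne_iff_sum (hA : A.PosDef) (U : n → n → ℝ) (lam : n → ℝ)
    (horth : ∀ i j, U i ⬝ᵥ U j = if i = j then 1 else 0) (hcomp : ∀ x : n → ℝ, ∑ i, (U i ⬝ᵥ x) • U i = x)
    (heig : ∀ i, A *ᵥ U i = lam i • U i) (v : n → ℝ) (ht : 0 ≤ t) :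
    (A - t • vecMulVec v v).PosSemidef ↔ t * ∑ i, (U i ⬝ᵥ v) ^ 2 / lam i ≤ 1 := by
  rw [posSemidef_sub_rankOne_iff hA v ht, resolvent_eq_sum_sq_dotProduct_div hA U lam horth hcomp heig v]

/-! ## §4 Instantiation with Mathlib's orthonormal eigenvector basis -/

/-- Orthonormality of `Matrix.IsHermitian.eigenvectorBasis` in `dotProduct` form (real case). [folklore] -/
theorem eigenvectorBasis_dotProduct (hA : A.IsHermitian) (i j : n) :
    (⇑(hA.eigenvectorBasis i) : n → ℝ) ⬝ᵥ ⇑(hA.eigenvectorBasis j) = if i = j then 1 else 0 := by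
  have h := (orthonormal_iff_ite.1 hA.eigenvectorBasis.orthonormal) i j
  rw [EuclideanSpace.inner_eq_star_dotProduct, star_trivial, dotProduct_comm] at h
  exact h

/-- Completeness of `Matrix.IsHermitian.eigenvectorBasis` in `dotProduct` form (real case): `Σ_i (u_i·x) u_i = x`. [folklore] -/
theorem sum_dotProduct_smul_eigenvectorBasis (hA : A.IsHermitian) (x : n → ℝ) :
    ∑ i, ((⇑(hA.eigenvectorBasis i) : n → ℝ) ⬝ᵥ x) • (⇑(hA.eigenvectorBasis i) : n → ℝ) = x := by
  have h := congrArg WithLp.ofLp (hA.eigenvectorBasis.sum_repr' (WithLp.toLp 2 x))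
  rw [WithLp.ofLp_sum, WithLp.ofLp_toLp] at h
  simp_rw [WithLp.ofLp_smul, EuclideanSpace.inner_eq_star_dotProduct, star_trivial] at h
  simpa only [dotProduct_comm x] using h

/-- **The capacity as the spectral sum over Mathlib's eigen-decomposition**: for a positive definite real matrix `A` and every `v`,
`⟨v, A⁻¹v⟩ = Σ_i (u_i·v)²/λ_i` with `u_i = hA.isHermitian.eigenvectorBasis i`, `λ_i = hA.isHermitian.eigenvalues i`. [folklore] -/
theorem resolvent_eq_sum_eigenvectorBasis (hA : A.PosDef) (v : n → ℝ) :
    v ⬝ᵥ (A⁻¹ *ᵥ v) = ∑ i, ((⇑(hA.1.eigenvectorBasis i) : n → ℝ) ⬝ᵥ v) ^ 2 / hA.1.eigenvalues i :=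
  resolvent_eq_sum_sq_dotProduct_div hA _ _ (eigenvectorBasis_dotProduct hA.1) (sum_dotProduct_smul_eigenvectorBasis hA.1)
    hA.1.mulVec_eigenvectorBasis v

/-- … and XII-l's crossing over Mathlib's eigen-decomposition: `A − t·v vᵀ ⪰ 0 ↔ t·Σ_i (u_i·v)²/λ_i ≤ 1` (`t ≥ 0`). [folklore] -/
theorem posSemidef_sub_rankOne_iff_sum_eigenvectorBasis (hA : A.PosDef) (v : n → ℝ) (ht : 0 ≤ t) :
    (A - t • vecMulVec v v).PosSemidef ↔
      t * ∑ i, ((⇑(hA.1.eigenvectorBasis i) : n → ℝ) ⬝ᵥ v) ^ 2 / hA.1.eigenvalues i ≤ 1 := by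
  rw [posSemidef_sub_rankOne_iff hA v ht, resolvent_eq_sum_eigenvectorBasis hA v]

end Summit.RiemannHypothesis.RiemannHypothesis.Theorems.HandoffCapacitySpectral
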